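import Literature.NumberTheory.GaloisRepresentations.FramedGaloisRepInduce
import Literature.NumberTheory.Automorphic.AshSmithTheoryHeckeProofs
import Summits.Langlands.Langlands.Theorems.DedekindQuotient1951DoudMoorePermutationSupplyHyperplane

/-!
# Route `DedekindQuotient1951` (Langlands) — support `DoudMoorePermutationSupply`: the permutation
representation `Ind_{Γ_K}^{Γ_ℚ} 1`

For a number field `K` of degree `d` and a commutative topological coefficient ring `A`, the
permutation representation of `Γ_ℚ` on the `d` cosets `Γ_ℚ / res(Γ_K)`, realised as the tree's
induced representation `Ind_{Γ_K}^{Γ_ℚ} 1` (`FramedGaloisRep.induce ℚ hd 1`, rank `d * 1`) relabelled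
to rank `d` (`FramedRep.reindex`); no definition is introduced, the representation is written out.

* `permRep_apply` — its matrices are the permutation matrices of the coset action:
  entry `(i, j)` is `[c_i = σ • c_j]` for the labelling `c : Fin d ≃ Γ_ℚ / res(Γ_K)`
  (`absGaloisCosetEquiv`); `permRep_apply'` — the same via the permutation
  `idx ∘ (σ • ·) ∘ idx⁻¹` of `Fin d`; `sum_permRep` (unit column sums);
* `permCongr_toPerm_eq_one_iff` — that permutation is trivial iff every conjugate of `σ` lies in
  `res(Γ_K)`;
* `isUnramifiedAt_permRep`, `hasFrobCharpolyAt_permRep` — at a place `v` all of whose inertia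
  groups lie in `res(Γ_K)`, it is unramified with Frobenius characteristic polynomial
  `∏_{w ∣ v} (X^{f(w|v)} − 1)` (**Dedekind's theorem**: the cycle type of Frobenius on the cosets is
  the residue-degree pattern of `v` in `K`; from the tree's `FramedGaloisRep.hasFrobCharpolyAt_induce`);
* `prod_X_pow_sub_one_eq_map_prod` — the same product indexed, as in the route statement, by the
  prime factors of `(p) ⊆ 𝓞_K` with residue degrees over `ℤ`.

References: J. Neukirch, *Algebraic Number Theory* (1999), I §8 (8.3), I §9, VII §10 (10.4);
J.-P. Serre, *Linear representations of finite groups*, §3.3.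
-/

set_option linter.dupNamespace false

noncomputable section

open scoped NumberField
open Polynomial Matrix IsDedekindDomain Field
open Literature.NumberTheory.GaloisRepresentations

namespace Summit.Langlands.Langlands.Theorems.DedekindQuotient1951

universe v

/-! ### The matrices of the permutation representation -/

section Perm

variable (K : Type) [Field K] [NumberField K] {d : ℕ} (hd : Module.finrank ℚ K = d)
  (A : Type v) [CommRing A] [TopologicalSpace A]

/-- Extension by zero of the trivial homomorphism is the indicator of the image. [folklore] -/
theorem dotExtend_one_apply {H G M : Type*} [Group H] [Group G] [MulZeroOneClass M]
    {φ : H →* G} (hφ : Function.Injective φ) (g : G) [Decidable (g ∈ φ.range)] :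
    dotExtend φ (1 : H →* M) g = if g ∈ φ.range then 1 else 0 := by
  split_ifs with h
  · obtain ⟨a, rfl⟩ := h
    rw [dotExtend_apply_map hφ, MonoidHom.one_apply]
  · exact dotExtend_of_not_mem φ _ h

/-- **The matrices of `Ind_{Γ_K}^{Γ_ℚ} 1` are the permutation matrices of the coset action**:
entry `(i, j)` of the relabelled induced representation at `σ` is `1` if `c_i = σ • c_j` in
`Γ_ℚ / res(Γ_K)` (`c = (absGaloisCosetEquiv ℚ K hd)⁻¹` the chosen labelling of the cosets) and `0`
otherwise. [folklore] -/
theorem permRep_apply (σ : absoluteGaloisGroup ℚ) (i j : Fin d)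
    [Decidable ((absGaloisCosetEquiv ℚ K hd).symm i = σ • (absGaloisCosetEquiv ℚ K hd).symm j)] :
    ((FramedRep.reindex (finProdFinEquiv.symm.trans (Equiv.prodUnique (Fin d) (Fin 1)))
        ((1 : FramedGaloisRep K A 1).induce ℚ hd) σ : GL (Fin d) A) : Matrix (Fin d) (Fin d) A) i j =
      if (absGaloisCosetEquiv ℚ K hd).symm i = σ • (absGaloisCosetEquiv ℚ K hd).symm j
      then 1 else 0 := by
  classical
  rw [FramedRep.coe_reindex_apply, Matrix.reindex_apply, Matrix.submatrix_apply,
    Equiv.symm_trans_apply, Equiv.symm_trans_apply, Equiv.prodUnique_symm_apply,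
    Equiv.prodUnique_symm_apply, Equiv.symm_symm, FramedGaloisRep.induce_apply_coe_apply,
    Equiv.symm_apply_apply, Equiv.symm_apply_apply]
  have htm : FramedRep.toMatrixHom (1 : FramedGaloisRep K A 1) = 1 := MonoidHom.ext fun _ => rfl
  dsimp only
  rw [htm, dotExtend_one_apply (absGaloisRestrict_injective ℚ K)]
  change (if _ ∈ (absGaloisRestrict ℚ K).toMonoidHom.range then (1 : Matrix (Fin 1) (Fin 1) A)
    else 0) default default = _
  have hq : ((σ * absGaloisCosetRep ℚ K hd j : absoluteGaloisGroup ℚ) :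
      absoluteGaloisGroup ℚ ⧸ (absGaloisRestrict ℚ K).range) = σ • (absGaloisCosetEquiv ℚ K hd).symm j := by
    rw [← mk_absGaloisCosetRep ℚ K hd j, MulAction.Quotient.smul_coe, smul_eq_mul]
  rw [inv_mul_mul_mem_range_iff, mk_absGaloisCosetRep]
  erw [hq]
  split_ifs <;> simp

/-- The same entries through the permutation `idx ∘ (σ • ·) ∘ idx⁻¹` of `Fin d`
(`idx = absGaloisCosetEquiv ℚ K hd`): entry `(i, j)` is `[p_σ j = i]`. [folklore] -/
theorem permRep_apply' (σ : absoluteGaloisGroup ℚ) (i j : Fin d) :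
    ((FramedRep.reindex (finProdFinEquiv.symm.trans (Equiv.prodUnique (Fin d) (Fin 1)))
        ((1 : FramedGaloisRep K A 1).induce ℚ hd) σ : GL (Fin d) A) : Matrix (Fin d) (Fin d) A) i j =
      if Equiv.permCongrHom (absGaloisCosetEquiv ℚ K hd)
          (MulAction.toPerm σ :
            Equiv.Perm (absoluteGaloisGroup ℚ ⧸ (absGaloisRestrict ℚ K).range)) j = i
      then 1 else 0 := by
  classical
  rw [permRep_apply]
  congr 1
  refine propext ⟨fun h => ?_, fun h => ?_⟩
  · change (absGaloisCosetEquiv ℚ K hd) (σ • (absGaloisCosetEquiv ℚ K hd).symm j) = i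
    rw [← h, Equiv.apply_symm_apply]
  · change (absGaloisCosetEquiv ℚ K hd) (σ • (absGaloisCosetEquiv ℚ K hd).symm j) = i at h
    rw [← h, Equiv.symm_apply_apply]

/-- **Unit column sums** (permutation matrices). [folklore] -/
theorem sum_permRep (σ : absoluteGaloisGroup ℚ) (k : Fin d) :
    ∑ j, ((FramedRep.reindex (finProdFinEquiv.symm.trans (Equiv.prodUnique (Fin d) (Fin 1)))
        ((1 : FramedGaloisRep K A 1).induce ℚ hd) σ : GL (Fin d) A) : Matrix (Fin d) (Fin d) A) j k =
      1 :=
  sum_of_perm _ _ (permRep_apply' K hd A σ) k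

end Perm

/-- **The coset permutation of `σ` is trivial iff every conjugate of `σ` lies in the subgroup.**
[folklore] -/
theorem permCongr_toPerm_eq_one_iff {G X : Type*} [Group G] (H : Subgroup G) (e : G ⧸ H ≃ X)
    (σ : G) :
    Equiv.permCongrHom e (MulAction.toPerm σ : Equiv.Perm (G ⧸ H)) = 1 ↔
      ∀ x : G, x⁻¹ * σ * x ∈ H := by
  constructor
  · intro h x
    have hx := Equiv.ext_iff.mp h (e (x : G ⧸ H))
    change e (σ • e.symm (e (x : G ⧸ H))) = e (x : G ⧸ H) at hx
    rw [Equiv.symm_apply_apply, e.apply_eq_iff_eq, MulAction.Quotient.smul_coe, smul_eq_mul,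
      QuotientGroup.eq] at hx
    have := H.inv_mem hx
    rwa [show ((σ * x)⁻¹ * x)⁻¹ = x⁻¹ * σ * x by group] at this
  · intro h
    ext y
    change e (σ • e.symm y) = y
    obtain ⟨x, hx⟩ := QuotientGroup.mk_surjective (e.symm y)
    rw [← hx, MulAction.Quotient.smul_coe, smul_eq_mul, e.apply_eq_iff_eq_symm_apply, ← hx,
      QuotientGroup.eq]
    have := H.inv_mem (h x)
    rwa [show (x⁻¹ * σ * x)⁻¹ = (σ * x)⁻¹ * x by group] at this

/-! ### Ramification and Frobenius: Dedekind's theorem -/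

section Frobenius

variable (K : Type) [Field K] [NumberField K] {d : ℕ} (hd : Module.finrank ℚ K = d)
  (A : Type v) [CommRing A] [TopologicalSpace A]

/-- **`Ind_{Γ_K}^{Γ_ℚ} 1` is unramified at every place all of whose inertia groups lie in
`res(Γ_K)`.** [folklore] -/
theorem isUnramifiedAt_permRep {v : HeightOneSpectrum (𝓞 ℚ)}
    (hI : ∀ 𝔓 ∈ v.primesAbove,
      𝔓.inertia (absoluteGaloisGroup ℚ) ≤ (absGaloisRestrict ℚ K).range) :
    FramedGaloisRep.IsUnramifiedAt v
      (FramedRep.reindex (finProdFinEquiv.symm.trans (Equiv.prodUnique (Fin d) (Fin 1)))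
        ((1 : FramedGaloisRep K A 1).induce ℚ hd)) := by
  rw [FramedGaloisRep.isUnramifiedAt_reindex_iff]
  exact FramedGaloisRep.isUnramifiedAt_induce ℚ hd (1 : FramedGaloisRep K A 1) hI
    fun w _ _ _ _ _ => rfl

omit [NumberField K] in
/-- The trivial rank-one representation has Frobenius characteristic polynomial `X - 1`.
[folklore] -/
theorem hasFrobCharpolyAt_one (w : HeightOneSpectrum (𝓞 K)) :
    (1 : FramedGaloisRep K A 1).HasFrobCharpolyAt w (X - 1) := by
  intro 𝔔 _ s _
  rw [FramedRep.charpoly, Matrix.charpoly, Matrix.det_fin_one, Matrix.charmatrix_apply,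
    Matrix.diagonal_apply_eq]
  change X - C (((1 : GL (Fin 1) A) : Matrix (Fin 1) (Fin 1) A) 0 0) = X - 1
  rw [Units.val_one, Matrix.one_apply_eq, map_one]

/-- **Dedekind's theorem for `Ind_{Γ_K}^{Γ_ℚ} 1`.**  At a finite place `v` of `ℚ` all of whose inertia
groups lie in `res(Γ_K)`, every arithmetic Frobenius has characteristic polynomial
`∏_{w ∣ v} (X^{f(w|v)} − 1)` on the permutation representation (the cycle lengths of Frobenius on
`Γ_ℚ / res(Γ_K)` are the residue degrees of the places of `K` above `v`).
Ref: Neukirch, *Algebraic Number Theory*, I §9, VII §10 (10.4) (iv). [folklore] -/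
theorem hasFrobCharpolyAt_permRep {v : HeightOneSpectrum (𝓞 ℚ)}
    (hI : ∀ 𝔓 ∈ v.primesAbove,
      𝔓.inertia (absoluteGaloisGroup ℚ) ≤ (absGaloisRestrict ℚ K).range)
    [Fintype {w : HeightOneSpectrum (𝓞 K) // w.under (𝓞 ℚ) = v}] :
    FramedGaloisRep.HasFrobCharpolyAt v
      (∏ w : {w : HeightOneSpectrum (𝓞 K) // w.under (𝓞 ℚ) = v},
        (X ^ w.1.asIdeal.inertiaDeg (𝓞 ℚ) - 1 : A[X]))
      (FramedRep.reindex (finProdFinEquiv.symm.trans (Equiv.prodUnique (Fin d) (Fin 1)))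
        ((1 : FramedGaloisRep K A 1).induce ℚ hd)) := by
  rw [FramedGaloisRep.hasFrobCharpolyAt_reindex_iff]
  have h := FramedGaloisRep.hasFrobCharpolyAt_induce ℚ hd (1 : FramedGaloisRep K A 1) hI
    (P := fun _ => X - 1) fun w _ => hasFrobCharpolyAt_one K A w
  rw [inducedFrobPolynomial_eq_prod] at h
  simp only [sub_comp, X_comp, one_comp] at h
  convert h

/-! ### Reindexing the product by the prime factors of `(p) ⊆ 𝓞_K` -/

/-- For a prime `𝔭 ∣ p` of `𝓞_K`, the residue degree over `ℤ` equals the residue degree over `𝓞_ℚ`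
(both exponents of `p` in `N𝔭`). [folklore] -/
theorem inertiaDeg_int_eq {v : HeightOneSpectrum (𝓞 ℚ)} (w : HeightOneSpectrum (𝓞 K))
    (hw : w.asIdeal.under (𝓞 ℚ) = v.asIdeal) :
    w.asIdeal.inertiaDeg ℤ = w.asIdeal.inertiaDeg (𝓞 ℚ) := by
  set p := Rat.HeightOneSpectrum.natGenerator v with hp
  have hpp : p.Prime := Rat.HeightOneSpectrum.prime_natGenerator v
  have hres : v.residueCard = p := Rat.residueCard_eq_natGenerator v
  -- `𝔭` lies over `(p) ⊆ ℤ`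
  have hpw : ((p : ℤ) : 𝓞 K) ∈ w.asIdeal := by
    have h1 : ((p : ℕ) : 𝓞 ℚ) ∈ v.asIdeal := by
      rw [Rat.asIdeal_eq_span_natGenerator]; exact Ideal.subset_span rfl
    have h2 : algebraMap (𝓞 ℚ) (𝓞 K) ((p : ℕ) : 𝓞 ℚ) ∈ w.asIdeal := by
      rw [← Ideal.mem_comap]
      change _ ∈ w.asIdeal.under (𝓞 ℚ)
      rw [hw]; exact h1
    rw [map_natCast] at h2
    rwa [Int.cast_natCast]
  haveI : w.asIdeal.LiesOver (Ideal.span {(p : ℤ)}) :=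
    (Ideal.liesOver_span_iff w.isPrime.ne_top (Nat.prime_iff_prime_int.mp hpp)).mpr
      (by rwa [eq_intCast])
  haveI : w.asIdeal.IsMaximal := w.isMaximal
  haveI : (Ideal.span {(p : ℤ)}).IsMaximal :=
    ((Ideal.span_singleton_prime (by exact_mod_cast hpp.ne_zero)).mpr
      (Nat.prime_iff_prime_int.mp hpp)).isMaximal (by simpa using hpp.ne_zero)
  have h1 : Ideal.absNorm w.asIdeal = p ^ w.asIdeal.inertiaDeg ℤ := by
    rw [Ideal.absNorm_eq_pow_inertiaDeg' w.asIdeal hpp, Ideal.inertiaDeg'_eq_inertiaDeg]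
  have h2 : Ideal.absNorm w.asIdeal = p ^ w.asIdeal.inertiaDeg (𝓞 ℚ) := by
    rw [← hres]
    exact residueCard_eq_pow_inertiaDeg_of_under_eq hw
  exact Nat.pow_right_injective hpp.two_le (h1.symm.trans h2)

omit [TopologicalSpace A] in
/-- **The Dedekind product indexed by prime factors**: the product of `X^{f(w|v)} − 1` over the
places `w ∣ v` of `K` equals, after mapping from `ℤ[X]`, the product of `X^{f(𝔭|p)} − 1` over the
prime factors `𝔭` of `(p) = (N v) ⊆ 𝓞_K` with residue degrees over `ℤ` (the shape used in the route
statement). [folklore] -/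
theorem prod_X_pow_sub_one_eq_map_prod (v : HeightOneSpectrum (𝓞 ℚ))
    [Fintype {w : HeightOneSpectrum (𝓞 K) // w.under (𝓞 ℚ) = v}] :
    (∏ w : {w : HeightOneSpectrum (𝓞 K) // w.under (𝓞 ℚ) = v},
        (X ^ w.1.asIdeal.inertiaDeg (𝓞 ℚ) - 1 : A[X])) =
      (∏ 𝔭 ∈ (UniqueFactorizationMonoid.factors
          (Ideal.span {((v.residueCard : ℕ) : 𝓞 K)})).toFinset,
        (X ^ (𝔭.inertiaDeg ℤ) - 1 : ℤ[X])).map (Int.castRingHom A) := by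
  classical
  rw [Polynomial.map_prod]
  simp only [Polynomial.map_sub, Polynomial.map_pow, Polynomial.map_X, Polynomial.map_one]
  -- `(N v) 𝓞_K` is the pushforward of `v`
  have hv0 : v.asIdeal ≠ ⊥ := v.ne_bot
  haveI := v.isMaximal
  have hspan : Ideal.span {((v.residueCard : ℕ) : 𝓞 K)} = v.asIdeal.map (algebraMap (𝓞 ℚ) (𝓞 K)) := by
    rw [Rat.asIdeal_eq_span_natGenerator v, Ideal.map_span, Set.image_singleton, map_natCast,
      Rat.residueCard_eq_natGenerator]
  rw [hspan]
  change _ = ∏ 𝔭 ∈ IsDedekindDomain.primesOverFinset v.asIdeal (𝓞 K), _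
  -- the bijection `w ↦ w.asIdeal` between places above `v` and prime factors
  refine Finset.prod_bij' (fun w _ => w.1.asIdeal)
    (fun 𝔭 h𝔭 => ⟨⟨𝔭, ((IsDedekindDomain.mem_primesOverFinset_iff hv0 (𝓞 K)).mp h𝔭).1,
      Ideal.ne_bot_of_mem_primesOver hv0
        ((IsDedekindDomain.mem_primesOverFinset_iff hv0 (𝓞 K)).mp h𝔭)⟩,
      HeightOneSpectrum.ext
        ((IsDedekindDomain.mem_primesOverFinset_iff hv0 (𝓞 K)).mp h𝔭).2.over.symm⟩)
    ?_ ?_ ?_ ?_ ?_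
  · intro w _
    rw [IsDedekindDomain.mem_primesOverFinset_iff hv0]
    exact ⟨w.1.isPrime, ⟨(congrArg HeightOneSpectrum.asIdeal w.2).symm⟩⟩
  · intro 𝔭 h𝔭
    exact Finset.mem_univ _
  · intro w _
    rfl
  · intro 𝔭 h𝔭
    rfl
  · intro w _
    rw [inertiaDeg_int_eq K w.1 (congrArg HeightOneSpectrum.asIdeal w.2)]

end Frobenius

end Summit.Langlands.Langlands.Theorems.DedekindQuotient1951

end
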